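import Summits.QuantumAdvantage.QuantumAdvantage.Theorems.LinnikCubicClassGroupsDegreeOnePrimesEscapeClassShortIntervalDHTheta
import Literature.NumberTheory.LFunctions.ClassGroupLFunctionNoExceptionalZeroOddDegree
import Literature.NumberTheory.LFunctions.ClassGroupLFunctionExceptionalZeroOfNoSiegel
import HarnessLib

/-!
# Prime ideals of a class in short intervals with Deuring–Heilbronn, VII: far exceptional zeros and odd degree

Topic `Summits/QuantumAdvantage/QuantumAdvantage/Theorems`, cell B2b-1 (linnik-cubic), PART A (gen 19); helper
toward the crux `DegreeOnePrimesEscape` (stmt-QuantumAdvantage-11543) of route `LinnikCubicClassGroups`.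
HONEST FRAMING: the value of this file is a THEOREM (kernel-checked, GRH-free, Siegel-free) — NOT summit progress.

* `rpow_sub_one_le_of_far` — an exceptional zero `β₁ ≤ 1 − c'/(log|d_K| + log 4)` is harmless in the Linnik range:
  `x^{β₁−1} ≤ t` once `x ≥ Q^{a}`, `a ≥ (2/c') log(1/t)`;
* `classPsi_shortInterval_of_farZero` / `classPrimeCount_shortInterval_of_farZero` — if every real zero `β₁ < 1` of every
  real class group character of `K` satisfies `β₁ ≤ 1 − c'/(log|d_K| + log 4)` (any fixed `c' > 0`), then for every
  class `C`, `x ≥ Q^{a}`, `x^{1−δ} ≤ h ≤ x`: `|h_K(ψ_C(x+h) − ψ_C(x)) − h| ≤ κh` and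
  `|h_K·#{𝔭 ∈ C : x < N𝔭 ≤ x+h}·log x − h| ≤ κh`;
* `classPsi_shortInterval_dh_of_odd` / `classPrimeCount_shortInterval_of_odd` — **every number field of ODD degree `n`**
  (Stark: no real zero in `[1 − 1/(8(2n)! log|d_K|), 1)`, `classGroupLFunction_ne_zero_of_odd`): the TWO-SIDED class
  prime number theorem in all short intervals of the Linnik range with relative error `κ`, every class, unconditionally
  (gen 5 `classPsi_shortInterval_of_odd` was one-sided with constants `1/8, 4`);
* `classPsi_shortInterval_le_two_add` — Brun–Titchmarsh in all short intervals of the Linnik range, every class of every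
  field of degree `n`, unconditionally: `h_K(ψ_C(x+h) − ψ_C(x)) ≤ (2 + κ) h` (the factor `2` is the exceptional zero;
  gen 5 `classPsi_shortInterval_upper` had `8`);
* `classPrimeCount_shortInterval_of_noSiegelZeros` — the same for EVERY number field of degree `n`, CONDITIONAL on the
  no-Siegel-zero conjecture for real Dirichlet characters (tree `NoSiegelZeros`, via
  `classGroupLFunction_ne_zero_of_noSiegelZeros`).
References: G. Hoheisel (1930); [LagariasMontgomeryOdlyzko1979, §7]; [Stark1974, Theorem 3]; [ThornerZaman2019, Thm. 3.1].
-/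

noncomputable section

open Complex Real
open scoped NumberField nonZeroDivisors

namespace Summit.QuantumAdvantage.QuantumAdvantage.Theorems.DegreeOnePrimesEscape

open Literature.NumberTheory.LFunctions Literature.NumberTheory.LFunctions.NumberField
  Literature.NumberTheory.LFunctions.AbelianDensity

/-! ### A far exceptional zero is harmless -/

/-- **`x^{β₁−1} ≤ t` for a far zero**: if `β₁ ≤ 1 − c'/(log|d_K| + log 4)`, `Q = condQn K ≥ 12`, `|d_K| ≤ Q`,
`Q^{a} ≤ x` with `a ≥ (2/c')·log(1/t)` (`0 < t`), then `x^{β₁−1} ≤ t`. -/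
theorem rpow_sub_one_le_of_far {K : Type} [Field K] [NumberField K] (hK : 1 < Module.finrank ℚ K)
    {c' t a x β₁ : ℝ} (hc' : 0 < c') (ht : 0 < t) (ha : 2 / c' * Real.log (1 / t) ≤ a) (ha0 : 0 ≤ a)
    (hx : ThornerZaman.condQn K ^ a ≤ x)
    (hβ : β₁ ≤ 1 - c' / (Real.log ((NumberField.discr K).natAbs : ℝ) + Real.log 4)) :
    x ^ (β₁ - 1) ≤ t := by
  set Q : ℝ := ThornerZaman.condQn K with hQ
  have hQ12 : (12 : ℝ) ≤ Q := ThornerZaman.twelve_le_condQn (K := K) hK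
  have hQ0 : 0 < Q := by linarith
  have hdQ : ((NumberField.discr K).natAbs : ℝ) ≤ Q := natAbs_discr_le_condQn K
  have hd1 : (1 : ℝ) ≤ ((NumberField.discr K).natAbs : ℝ) := by
    have := NumberField.abs_discr_gt_two hK
    rw [Nat.cast_natAbs]; exact_mod_cast (show (1 : ℤ) ≤ |NumberField.discr K| by omega)
  have hlogd0 : 0 ≤ Real.log ((NumberField.discr K).natAbs : ℝ) := Real.log_nonneg hd1
  have hlog4 : 0 < Real.log 4 := Real.log_pos (by norm_num)
  have hlogQ : 0 < Real.log Q := Real.log_pos (by linarith)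
  have hden : Real.log ((NumberField.discr K).natAbs : ℝ) + Real.log 4 ≤ 2 * Real.log Q := by
    have h1 := Real.log_le_log (by linarith) hdQ
    have h2 : Real.log 4 ≤ Real.log Q := Real.log_le_log (by norm_num) (by linarith)
    linarith
  have hden0 : 0 < Real.log ((NumberField.discr K).natAbs : ℝ) + Real.log 4 := by linarith
  have hxQ : Q ^ a ≤ x := hx
  have hx0 : 0 < x := lt_of_lt_of_le (Real.rpow_pos_of_pos hQ0 _) hxQ
  have hlogx : a * Real.log Q ≤ Real.log x := by
    have := Real.log_le_log (Real.rpow_pos_of_pos hQ0 _) hxQ; rwa [Real.log_rpow hQ0] at this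
  -- `(1 − β₁) log x ≥ c' log x/(log d + log 4) ≥ c' a log Q/(2 log Q) = c' a/2 ≥ log(1/t)`
  have h1 : c' / (Real.log ((NumberField.discr K).natAbs : ℝ) + Real.log 4) ≤ 1 - β₁ := by linarith
  have h2 : c' / (2 * Real.log Q) ≤ c' / (Real.log ((NumberField.discr K).natAbs : ℝ) + Real.log 4) :=
    div_le_div_of_nonneg_left hc'.le hden0 hden
  have hq : 0 < c' / (Real.log ((NumberField.discr K).natAbs : ℝ) + Real.log 4) := div_pos hc' hden0
  have h3 : Real.log (1 / t) ≤ (1 - β₁) * Real.log x := by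
    have h4 : c' / (2 * Real.log Q) * (a * Real.log Q) = c' * a / 2 := by field_simp
    have h5 : c' / (2 * Real.log Q) * (a * Real.log Q) ≤ (1 - β₁) * Real.log x :=
      mul_le_mul (h2.trans h1) hlogx (by positivity) (by linarith)
    have h6 : Real.log (1 / t) ≤ c' * a / 2 := by
      have := mul_le_mul_of_nonneg_left ha hc'.le
      have e : c' * (2 / c' * Real.log (1 / t)) = 2 * Real.log (1 / t) := by field_simp
      linarith
    linarith
  rw [Real.rpow_def_of_pos hx0, show Real.log x * (β₁ - 1) = -((1 - β₁) * Real.log x) by ring]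
  calc Real.exp (-((1 - β₁) * Real.log x)) ≤ Real.exp (-Real.log (1 / t)) := Real.exp_le_exp.2 (by linarith)
    _ = t := by rw [Real.exp_neg, Real.exp_log (by positivity)]; simp

/-- In odd degree every real zero of a real class group character is far: `β₁ ≤ 1 − c'/(log|d_K| + log 4)` with
`c' = 1/(8(2n)!)` (Stark). [cite: Stark1974, Theorem 3] -/
theorem realZero_far_of_odd {K : Type} [Field K] [NumberField K] (hodd : Odd (Module.finrank ℚ K))
    (hK : 1 < Module.finrank ℚ K) (χ₁ : ClassGroup (𝓞 K) →* ℂˣ) (hreal : χ₁ * χ₁ = 1) {β₁ : ℝ} (hβ1 : β₁ < 1)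
    (hLz : classGroupLFunction K χ₁ β₁ = 0) :
    β₁ ≤ 1 - 1 / (8 * ((2 * Module.finrank ℚ K).factorial : ℝ)) /
      (Real.log ((NumberField.discr K).natAbs : ℝ) + Real.log 4) := by
  by_contra hlt
  rw [not_le] at hlt
  have hd3 : (3 : ℝ) ≤ ((NumberField.discr K).natAbs : ℝ) := by
    have h2 := NumberField.abs_discr_gt_two hK
    rw [Nat.cast_natAbs]
    exact_mod_cast (show (3 : ℤ) ≤ |NumberField.discr K| by omega)
  have hlogd : 0 < Real.log ((NumberField.discr K).natAbs : ℝ) := Real.log_pos (by linarith)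
  have hlog4 : 0 < Real.log 4 := Real.log_pos (by norm_num)
  have hσ : 1 - 1 / (8 * ((2 * Module.finrank ℚ K).factorial : ℝ) * Real.log ((NumberField.discr K).natAbs : ℝ)) ≤ β₁ := by
    have h1 : 1 / (8 * ((2 * Module.finrank ℚ K).factorial : ℝ)) / (Real.log ((NumberField.discr K).natAbs : ℝ) + Real.log 4) ≤
        1 / (8 * ((2 * Module.finrank ℚ K).factorial : ℝ)) / Real.log ((NumberField.discr K).natAbs : ℝ) :=
      div_le_div_of_nonneg_left (by positivity) hlogd (by linarith)
    have h2 : 1 / (8 * ((2 * Module.finrank ℚ K).factorial : ℝ)) / Real.log ((NumberField.discr K).natAbs : ℝ) =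
        1 / (8 * ((2 * Module.finrank ℚ K).factorial : ℝ) * Real.log ((NumberField.discr K).natAbs : ℝ)) := by
      rw [div_div]
    linarith
  exact classGroupLFunction_ne_zero_of_odd K hodd hK χ₁ hreal hσ hβ1 hLz

/-! ### The `ψ_C`-form without exceptional term -/

set_option maxHeartbeats 1600000 in
/-- **Far exceptional zeros do not matter**: for `n > 1`, `κ > 0`, `c' > 0` there are `δ ∈ (0,1/64]`, `a ≥ 1` such that
for every number field `K` of degree `n` all of whose real class-group-character zeros `β₁ < 1` satisfy
`β₁ ≤ 1 − c'/(log|d_K| + log 4)`, every class `C`, `x ≥ Q^{a}`, `x^{1−δ} ≤ h ≤ x`: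
`|h_K(ψ_C(x+h) − ψ_C(x)) − h| ≤ κ h`. -/
theorem classPsi_shortInterval_of_farZero (n : ℕ) (hn : 1 < n) {κ : ℝ} (hκ : 0 < κ) {c' : ℝ} (hc' : 0 < c') :
    ∃ δ a : ℝ, 0 < δ ∧ δ ≤ 1 / 64 ∧ 1 ≤ a ∧
    ∀ (K : Type) [Field K] [NumberField K], Module.finrank ℚ K = n →
      (∀ (χ₁ : ClassGroup (𝓞 K) →* ℂˣ) (β₁ : ℝ), χ₁ * χ₁ = 1 → β₁ < 1 → classGroupLFunction K χ₁ β₁ = 0 →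
          β₁ ≤ 1 - c' / (Real.log ((NumberField.discr K).natAbs : ℝ) + Real.log 4)) →
      ∀ (C : ClassGroup (𝓞 K)) (x h : ℝ), ThornerZaman.condQn K ^ a ≤ x → x ^ (1 - δ) ≤ h → h ≤ x →
        |(NumberField.classNumber K : ℝ) * (classPsi K C (x + h) - classPsi K C x) - h| ≤ κ * h := by
  obtain ⟨δ, a, c, hδ, hδ64, ha, hc, hcn, hmain⟩ := classPsi_shortInterval_dh n hn (half_pos hκ)
  have ht : 0 < κ / 4 := by positivity
  set a' : ℝ := max a (2 / c' * Real.log (1 / (κ / 4))) with ha'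
  refine ⟨δ, a', hδ, hδ64, le_max_of_le_left ha, fun K _ _ hKn hfar C x h hx hhx hhx' ↦ ?_⟩
  have hK : 1 < Module.finrank ℚ K := by rw [hKn]; exact hn
  have hQ12 : (12 : ℝ) ≤ ThornerZaman.condQn K := ThornerZaman.twelve_le_condQn (K := K) hK
  have hQ1 : (1 : ℝ) ≤ ThornerZaman.condQn K := by linarith
  have hxa : ThornerZaman.condQn K ^ a ≤ x := (Real.rpow_le_rpow_of_exponent_le hQ1 (le_max_left _ _)).trans hx
  have hQx : ThornerZaman.condQn K ≤ x := by
    have := (Real.rpow_le_rpow_of_exponent_le hQ1 ha).trans hxa; rwa [Real.rpow_one] at this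
  have hx0 : 0 < x := by linarith
  have hh0 : 0 < h := lt_of_lt_of_le (Real.rpow_pos_of_pos hx0 _) hhx
  obtain ⟨hA, hB⟩ := hmain K hKn C x h hxa hhx hhx'
  by_cases hex : ∃ (χ₁ : ClassGroup (𝓞 K) →* ℂˣ) (β₁ : ℝ), χ₁ * χ₁ = 1 ∧ classGroupLFunction K χ₁ β₁ = 0 ∧
      1 - c / (Real.log ((NumberField.discr K).natAbs : ℝ) + Real.log 4) < β₁ ∧ β₁ < 1
  · obtain ⟨χ₁, β₁, hreal, hLz, hwin, hβ1⟩ := hex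
    have hβfar := hfar χ₁ β₁ hreal hβ1 hLz
    have hxβ : x ^ (β₁ - 1) ≤ κ / 4 :=
      rpow_sub_one_le_of_far hK hc' ht (le_max_right _ _) (by linarith [le_max_left a (2 / c' * Real.log (1 / (κ / 4)))])
        hx hβfar
    have hβhalf : 1 / 2 ≤ β₁ := half_le_of_window (N := K) (n₀ := n) hcn hwin
    have hI := rpow_window_div_le hx0 hh0.le (by linarith : 0 < β₁) hβ1.le
    have hIκ : ((x + h) ^ β₁ - x ^ β₁) / β₁ ≤ κ / 4 * h := by
      have := mul_le_mul_of_nonneg_left hxβ hh0.le; linarith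
    have hI0 : 0 ≤ ((x + h) ^ β₁ - x ^ β₁) / β₁ := by
      refine div_nonneg ?_ (by linarith)
      have := Real.rpow_le_rpow hx0.le (show x ≤ x + h by linarith) (by linarith : 0 ≤ β₁)
      linarith
    have hmin0 : 0 ≤ min 1 ((1 - β₁) * Real.log x) :=
      le_min zero_le_one (mul_nonneg (by linarith) (Real.log_nonneg (by linarith)))
    have hmin1 : min 1 ((1 - β₁) * Real.log x) ≤ 1 := min_le_left _ _
    obtain ⟨hflat, hplus⟩ := hB χ₁ β₁ hreal hLz hwin hβ1
    rcases classGroupChar_apply_eq_one_or_eq_neg_one hreal C with hC | hC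
    · have key := abs_le.1 (hflat hC)
      rw [abs_le]; constructor <;> nlinarith [key.1, key.2, mul_pos hκ hh0]
    · have key := abs_le.1 (hplus hC)
      have : κ / 2 * min 1 ((1 - β₁) * Real.log x) * h ≤ κ / 2 * h := by nlinarith [mul_pos hκ hh0]
      rw [abs_le]; constructor <;> nlinarith [key.1, key.2, mul_pos hκ hh0]
  · have := hA hex
    have h2 : κ / 2 * h ≤ κ * h := by nlinarith
    exact this.trans h2

/-- **The two-sided class prime number theorem in short intervals for every number field of ODD degree `n`, every class,
unconditionally** (`ψ_C`-form): `|h_K(ψ_C(x+h) − ψ_C(x)) − h| ≤ κ h` for `x ≥ Q^{a}`, `x^{1−δ} ≤ h ≤ x`.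
[cite: Stark1974, Theorem 3] [cite: LagariasMontgomeryOdlyzko1979, §7] -/
theorem classPsi_shortInterval_dh_of_odd (n : ℕ) (hn : 1 < n) (hodd : Odd n) {κ : ℝ} (hκ : 0 < κ) :
    ∃ δ a : ℝ, 0 < δ ∧ δ ≤ 1 / 64 ∧ 1 ≤ a ∧
    ∀ (K : Type) [Field K] [NumberField K], Module.finrank ℚ K = n →
      ∀ (C : ClassGroup (𝓞 K)) (x h : ℝ), ThornerZaman.condQn K ^ a ≤ x → x ^ (1 - δ) ≤ h → h ≤ x →
        |(NumberField.classNumber K : ℝ) * (classPsi K C (x + h) - classPsi K C x) - h| ≤ κ * h := by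
  obtain ⟨δ, a, hδ, hδ64, ha, hmain⟩ := classPsi_shortInterval_of_farZero n hn hκ
    (c' := 1 / (8 * ((2 * n).factorial : ℝ))) (by positivity)
  refine ⟨δ, a, hδ, hδ64, ha, fun K _ _ hKn C x h hx hhx hhx' ↦ hmain K hKn (fun χ₁ β₁ hreal hβ1 hLz ↦ ?_) C x h hx hhx hhx'⟩
  have hK : 1 < Module.finrank ℚ K := by rw [hKn]; exact hn
  have := realZero_far_of_odd (by rw [hKn]; exact hodd) hK χ₁ hreal hβ1 hLz
  rwa [hKn] at this

/-! ### The `π_C`-form without exceptional term -/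

set_option maxHeartbeats 1600000 in
/-- `π_C`-form of `classPsi_shortInterval_of_farZero`:
`|h_K·#{𝔭 ∈ C : x < N𝔭 ≤ x+h}·log x − h| ≤ κ h`. -/
theorem classPrimeCount_shortInterval_of_farZero (n : ℕ) (hn : 1 < n) {κ : ℝ} (hκ : 0 < κ) {c' : ℝ} (hc' : 0 < c') :
    ∃ δ a : ℝ, 0 < δ ∧ δ ≤ 1 / 64 ∧ 1 ≤ a ∧
    ∀ (K : Type) [Field K] [NumberField K], Module.finrank ℚ K = n →
      (∀ (χ₁ : ClassGroup (𝓞 K) →* ℂˣ) (β₁ : ℝ), χ₁ * χ₁ = 1 → β₁ < 1 → classGroupLFunction K χ₁ β₁ = 0 →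
          β₁ ≤ 1 - c' / (Real.log ((NumberField.discr K).natAbs : ℝ) + Real.log 4)) →
      ∀ (C : ClassGroup (𝓞 K)) (x h : ℝ), ThornerZaman.condQn K ^ a ≤ x → x ^ (1 - δ) ≤ h → h ≤ x →
        |(NumberField.classNumber K : ℝ) *
            ((primeIdealClassCount K C (x + h) : ℝ) - primeIdealClassCount K C x) * Real.log x - h| ≤ κ * h := by
  obtain ⟨δ, a, c, hδ, hδ64, ha, hc, hcn, hmain⟩ := classPrimeCount_shortInterval_dh n hn (half_pos hκ)
  have ht : 0 < κ / 4 := by positivity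
  set a' : ℝ := max a (2 / c' * Real.log (1 / (κ / 4))) with ha'
  refine ⟨δ, a', hδ, hδ64, le_max_of_le_left ha, fun K _ _ hKn hfar C x h hx hhx hhx' ↦ ?_⟩
  have hK : 1 < Module.finrank ℚ K := by rw [hKn]; exact hn
  have hQ12 : (12 : ℝ) ≤ ThornerZaman.condQn K := ThornerZaman.twelve_le_condQn (K := K) hK
  have hQ1 : (1 : ℝ) ≤ ThornerZaman.condQn K := by linarith
  have hxa : ThornerZaman.condQn K ^ a ≤ x := (Real.rpow_le_rpow_of_exponent_le hQ1 (le_max_left _ _)).trans hx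
  have hQx : ThornerZaman.condQn K ≤ x := by
    have := (Real.rpow_le_rpow_of_exponent_le hQ1 ha).trans hxa; rwa [Real.rpow_one] at this
  have hx0 : 0 < x := by linarith
  have hh0 : 0 < h := lt_of_lt_of_le (Real.rpow_pos_of_pos hx0 _) hhx
  obtain ⟨hA, hB⟩ := hmain K hKn C x h hxa hhx hhx'
  by_cases hex : ∃ (χ₁ : ClassGroup (𝓞 K) →* ℂˣ) (β₁ : ℝ), χ₁ * χ₁ = 1 ∧ classGroupLFunction K χ₁ β₁ = 0 ∧
      1 - c / (Real.log ((NumberField.discr K).natAbs : ℝ) + Real.log 4) < β₁ ∧ β₁ < 1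
  · obtain ⟨χ₁, β₁, hreal, hLz, hwin, hβ1⟩ := hex
    have hβfar := hfar χ₁ β₁ hreal hβ1 hLz
    have hxβ : x ^ (β₁ - 1) ≤ κ / 4 :=
      rpow_sub_one_le_of_far hK hc' ht (le_max_right _ _) (by linarith [le_max_left a (2 / c' * Real.log (1 / (κ / 4)))])
        hx hβfar
    have hβhalf : 1 / 2 ≤ β₁ := half_le_of_window (N := K) (n₀ := n) hcn hwin
    have hI := rpow_window_div_le hx0 hh0.le (by linarith : 0 < β₁) hβ1.le
    have hIκ : ((x + h) ^ β₁ - x ^ β₁) / β₁ ≤ κ / 4 * h := by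
      have := mul_le_mul_of_nonneg_left hxβ hh0.le; linarith
    have hI0 : 0 ≤ ((x + h) ^ β₁ - x ^ β₁) / β₁ := by
      refine div_nonneg ?_ (by linarith)
      have := Real.rpow_le_rpow hx0.le (show x ≤ x + h by linarith) (by linarith : 0 ≤ β₁)
      linarith
    obtain ⟨hflat, hplus⟩ := hB χ₁ β₁ hreal hLz hwin hβ1
    rcases classGroupChar_apply_eq_one_or_eq_neg_one hreal C with hC | hC
    · have key := abs_le.1 (hflat hC)
      rw [abs_le]; constructor <;> nlinarith [key.1, key.2, mul_pos hκ hh0]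
    · have key := abs_le.1 (hplus hC)
      rw [abs_le]; constructor <;> nlinarith [key.1, key.2, mul_pos hκ hh0]
  · have := hA hex
    have h2 : κ / 2 * h ≤ κ * h := by nlinarith
    exact this.trans h2

/-- **The class prime number theorem in short intervals, `π_C`-form, every number field of ODD degree `n`, every class,
unconditionally**: `|h_K·#{𝔭 ∈ C : x < N𝔭 ≤ x+h}·log x − h| ≤ κ h` for `x ≥ Q^{a}`, `x^{1−δ} ≤ h ≤ x` — i.e. every
class receives `(1 ± κ)·h/(h_K log x)` prime ideals from every such interval (Hoheisel's prime number theorem for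
ideal classes, uniform in the Linnik range). [cite: Stark1974, Theorem 3] [cite: LagariasMontgomeryOdlyzko1979, §7] -/
theorem classPrimeCount_shortInterval_of_odd (n : ℕ) (hn : 1 < n) (hodd : Odd n) {κ : ℝ} (hκ : 0 < κ) :
    ∃ δ a : ℝ, 0 < δ ∧ δ ≤ 1 / 64 ∧ 1 ≤ a ∧
    ∀ (K : Type) [Field K] [NumberField K], Module.finrank ℚ K = n →
      ∀ (C : ClassGroup (𝓞 K)) (x h : ℝ), ThornerZaman.condQn K ^ a ≤ x → x ^ (1 - δ) ≤ h → h ≤ x →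
        |(NumberField.classNumber K : ℝ) *
            ((primeIdealClassCount K C (x + h) : ℝ) - primeIdealClassCount K C x) * Real.log x - h| ≤ κ * h := by
  obtain ⟨δ, a, hδ, hδ64, ha, hmain⟩ := classPrimeCount_shortInterval_of_farZero n hn hκ
    (c' := 1 / (8 * ((2 * n).factorial : ℝ))) (by positivity)
  refine ⟨δ, a, hδ, hδ64, ha, fun K _ _ hKn C x h hx hhx hhx' ↦ hmain K hKn (fun χ₁ β₁ hreal hβ1 hLz ↦ ?_) C x h hx hhx hhx'⟩
  have hK : 1 < Module.finrank ℚ K := by rw [hKn]; exact hn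
  have := realZero_far_of_odd (by rw [hKn]; exact hodd) hK χ₁ hreal hβ1 hLz
  rwa [hKn] at this

/-- **Hoheisel's prime number theorem for ideal classes, every number field of ODD degree, threshold `|d_K|^L`**:
for odd `n > 1` and `κ > 0` there are `δ, L > 0` such that for every number field `K` of degree `n`, every class `C`,
every `x ≥ |d_K|^L` and `x^{1−δ} ≤ h ≤ x`: `|h_K·#{𝔭 ∈ C : x < N𝔭 ≤ x+h}·log x − h| ≤ κ h` — unconditionally.
[cite: Stark1974, Theorem 3] [cite: LagariasMontgomeryOdlyzko1979, §7] -/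
theorem classPrimeCount_shortInterval_of_odd_discr (n : ℕ) (hn : 1 < n) (hodd : Odd n) {κ : ℝ} (hκ : 0 < κ) :
    ∃ δ L : ℝ, 0 < δ ∧ 0 < L ∧
    ∀ (K : Type) [Field K] [NumberField K], Module.finrank ℚ K = n →
      ∀ (C : ClassGroup (𝓞 K)) (x h : ℝ), ((NumberField.discr K).natAbs : ℝ) ^ L ≤ x → x ^ (1 - δ) ≤ h → h ≤ x →
        |(NumberField.classNumber K : ℝ) *
            ((primeIdealClassCount K C (x + h) : ℝ) - primeIdealClassCount K C x) * Real.log x - h| ≤ κ * h := by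
  obtain ⟨δ, a, hδ, -, ha, hmain⟩ := classPrimeCount_shortInterval_of_odd n hn hodd hκ
  set e : ℝ := 1 + n * Real.log n / Real.log 3 with he
  have hn0 : (0 : ℝ) < n := by exact_mod_cast (lt_trans Nat.zero_lt_one hn)
  have hlogn : 0 ≤ Real.log n := Real.log_nonneg (by exact_mod_cast hn.le)
  have he1 : 1 ≤ e := by
    have : 0 ≤ n * Real.log n / Real.log 3 := div_nonneg (mul_nonneg hn0.le hlogn) (Real.log_nonneg (by norm_num))
    rw [he]; linarith
  refine ⟨δ, e * a, hδ, by positivity, fun K _ _ hKn C x h hx hhx hhx' ↦ hmain K hKn C x h ?_ hhx hhx'⟩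
  have hK : 1 < Module.finrank ℚ K := by rw [hKn]; exact hn
  have hQ12 : (12 : ℝ) ≤ ThornerZaman.condQn K := ThornerZaman.twelve_le_condQn (K := K) hK
  have hd1 : (1 : ℝ) ≤ ((NumberField.discr K).natAbs : ℝ) := by
    have := NumberField.abs_discr_gt_two hK
    rw [Nat.cast_natAbs]; exact_mod_cast (show (1 : ℤ) ≤ |NumberField.discr K| by omega)
  have hQd : ThornerZaman.condQn K ≤ ((NumberField.discr K).natAbs : ℝ) ^ e := by
    have := condQn_le_natAbs_discr_rpow K hK; rwa [hKn, ← he] at this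
  refine le_trans ?_ hx
  rw [Real.rpow_mul (by linarith)]
  exact Real.rpow_le_rpow (by linarith) hQd (by linarith)

/-! ### Under the no-Siegel-zero conjecture: every degree -/

/-- Under `NoSiegelZeros` every real zero `β₁ < 1` of a real class group character of a field of degree `n > 1` is far:
`β₁ ≤ 1 − c'/(log|d_K| + log 4)` with `c' = c/(2n)!`.  CONDITIONAL on the open conjecture `NoSiegelZeros`. -/
theorem realZero_far_of_noSiegelZeros (hNS : NoSiegelZeros) (n : ℕ) (hn : 1 < n) :
    ∃ c' : ℝ, 0 < c' ∧ ∀ (K : Type) [Field K] [NumberField K], Module.finrank ℚ K = n →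
      ∀ (χ₁ : ClassGroup (𝓞 K) →* ℂˣ) (β₁ : ℝ), χ₁ * χ₁ = 1 → β₁ < 1 → classGroupLFunction K χ₁ β₁ = 0 →
        β₁ ≤ 1 - c' / (Real.log ((NumberField.discr K).natAbs : ℝ) + Real.log 4) := by
  obtain ⟨c, hc, hzf⟩ := classGroupLFunction_ne_zero_of_noSiegelZeros hNS
  refine ⟨c / ((2 * n).factorial : ℝ), by positivity, fun K _ _ hKn χ₁ β₁ hreal hβ1 hLz ↦ ?_⟩
  have hK : 1 < Module.finrank ℚ K := by rw [hKn]; exact hn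
  by_contra hlt
  rw [not_le] at hlt
  have hd3 : (3 : ℝ) ≤ ((NumberField.discr K).natAbs : ℝ) := by
    have h2 := NumberField.abs_discr_gt_two hK
    rw [Nat.cast_natAbs]
    exact_mod_cast (show (3 : ℤ) ≤ |NumberField.discr K| by omega)
  have hlogd : 0 < Real.log ((NumberField.discr K).natAbs : ℝ) := Real.log_pos (by linarith)
  have hlog4 : 0 < Real.log 4 := Real.log_pos (by norm_num)
  have hfac : (0 : ℝ) < ((2 * n).factorial : ℝ) := by exact_mod_cast Nat.factorial_pos _
  have h1 : c / ((2 * n).factorial : ℝ) / (Real.log ((NumberField.discr K).natAbs : ℝ) + Real.log 4) ≤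
      c / ((2 * n).factorial : ℝ) / Real.log ((NumberField.discr K).natAbs : ℝ) :=
    div_le_div_of_nonneg_left (by positivity) hlogd (by linarith)
  have h2 : c / ((2 * n).factorial : ℝ) / Real.log ((NumberField.discr K).natAbs : ℝ) =
      c / (((2 * Module.finrank ℚ K).factorial : ℝ) * Real.log ((NumberField.discr K).natAbs : ℝ)) := by
    rw [div_div, hKn]
  exact hzf K hK χ₁ hreal β₁ (by linarith) hβ1 hLz

/-- **Under `NoSiegelZeros`: Hoheisel's prime number theorem for every ideal class of every number field of degree `n`,
two-sided with relative error `κ`**: `|h_K·#{𝔭 ∈ C : x < N𝔭 ≤ x+h}·log x − h| ≤ κ h` for `x ≥ Q^{a}`,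
`x^{1−δ} ≤ h ≤ x`.  CONDITIONAL on the open conjecture `NoSiegelZeros` (the unconditional statements are
`classPrimeCount_shortInterval_dh` and, in odd degree, `classPrimeCount_shortInterval_of_odd`). -/
theorem classPrimeCount_shortInterval_of_noSiegelZeros (hNS : NoSiegelZeros) (n : ℕ) (hn : 1 < n) {κ : ℝ}
    (hκ : 0 < κ) :
    ∃ δ a : ℝ, 0 < δ ∧ δ ≤ 1 / 64 ∧ 1 ≤ a ∧
    ∀ (K : Type) [Field K] [NumberField K], Module.finrank ℚ K = n →
      ∀ (C : ClassGroup (𝓞 K)) (x h : ℝ), ThornerZaman.condQn K ^ a ≤ x → x ^ (1 - δ) ≤ h → h ≤ x →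
        |(NumberField.classNumber K : ℝ) *
            ((primeIdealClassCount K C (x + h) : ℝ) - primeIdealClassCount K C x) * Real.log x - h| ≤ κ * h := by
  obtain ⟨c', hc', hfar⟩ := realZero_far_of_noSiegelZeros hNS n hn
  obtain ⟨δ, a, hδ, hδ64, ha, hmain⟩ := classPrimeCount_shortInterval_of_farZero n hn hκ hc'
  exact ⟨δ, a, hδ, hδ64, ha, fun K _ _ hKn C x h hx hhx hhx' ↦ hmain K hKn (hfar K hKn) C x h hx hhx hhx'⟩

/-! ### Brun–Titchmarsh in all short intervals, every class -/

/-- **Brun–Titchmarsh for ideal classes in short intervals of the Linnik range, every class of every number field of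
degree `n`, unconditionally**: `h_K(ψ_C(x+h) − ψ_C(x)) ≤ (2 + κ)·h` for `x ≥ Q^{a}`, `x^{1−δ} ≤ h ≤ x`. -/
theorem classPsi_shortInterval_le_two_add (n : ℕ) (hn : 1 < n) {κ : ℝ} (hκ : 0 < κ) :
    ∃ δ a : ℝ, 0 < δ ∧ δ ≤ 1 / 64 ∧ 1 ≤ a ∧
    ∀ (K : Type) [Field K] [NumberField K], Module.finrank ℚ K = n →
      ∀ (C : ClassGroup (𝓞 K)) (x h : ℝ), ThornerZaman.condQn K ^ a ≤ x → x ^ (1 - δ) ≤ h → h ≤ x →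
        (NumberField.classNumber K : ℝ) * (classPsi K C (x + h) - classPsi K C x) ≤ (2 + κ) * h := by
  obtain ⟨δ, a, c, hδ, hδ64, ha, hc, hcn, hmain⟩ := classPsi_shortInterval_dh n hn hκ
  refine ⟨δ, a, hδ, hδ64, ha, fun K _ _ hKn C x h hx hhx hhx' ↦ ?_⟩
  have hK : 1 < Module.finrank ℚ K := by rw [hKn]; exact hn
  have hQ12 : (12 : ℝ) ≤ ThornerZaman.condQn K := ThornerZaman.twelve_le_condQn (K := K) hK
  have hQx : ThornerZaman.condQn K ≤ x := by
    have := (Real.rpow_le_rpow_of_exponent_le (by linarith : (1 : ℝ) ≤ ThornerZaman.condQn K) ha).trans hx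
    rwa [Real.rpow_one] at this
  have hx0 : 0 < x := by linarith
  have hh0 : 0 < h := lt_of_lt_of_le (Real.rpow_pos_of_pos hx0 _) hhx
  obtain ⟨hA, hB⟩ := hmain K hKn C x h hx hhx hhx'
  by_cases hex : ∃ (χ₁ : ClassGroup (𝓞 K) →* ℂˣ) (β₁ : ℝ), χ₁ * χ₁ = 1 ∧ classGroupLFunction K χ₁ β₁ = 0 ∧
      1 - c / (Real.log ((NumberField.discr K).natAbs : ℝ) + Real.log 4) < β₁ ∧ β₁ < 1
  · obtain ⟨χ₁, β₁, hreal, hLz, hwin, hβ1⟩ := hex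
    have hβhalf : 1 / 2 ≤ β₁ := half_le_of_window (N := K) (n₀ := n) hcn hwin
    have hI0 : 0 ≤ ((x + h) ^ β₁ - x ^ β₁) / β₁ := by
      refine div_nonneg ?_ (by linarith)
      have := Real.rpow_le_rpow hx0.le (show x ≤ x + h by linarith) (by linarith : 0 ≤ β₁)
      linarith
    have hIh : ((x + h) ^ β₁ - x ^ β₁) / β₁ ≤ h := by
      have h1 := rpow_window_div_le hx0 hh0.le (by linarith : 0 < β₁) hβ1.le
      have h2 : x ^ (β₁ - 1) ≤ 1 := Real.rpow_le_one_of_one_le_of_nonpos (by linarith) (by linarith)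
      have h3 := mul_le_mul_of_nonneg_left h2 hh0.le
      linarith
    have hmin0 : 0 ≤ min 1 ((1 - β₁) * Real.log x) :=
      le_min zero_le_one (mul_nonneg (by linarith) (Real.log_nonneg (by linarith)))
    have hmin1 : min 1 ((1 - β₁) * Real.log x) ≤ 1 := min_le_left _ _
    obtain ⟨hflat, hplus⟩ := hB χ₁ β₁ hreal hLz hwin hβ1
    rcases classGroupChar_apply_eq_one_or_eq_neg_one hreal C with hC | hC
    · have key := (abs_le.1 (hflat hC)).2
      nlinarith [mul_pos hκ hh0]
    · have key := (abs_le.1 (hplus hC)).2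
      nlinarith [mul_pos hκ hh0]
  · have key := (abs_le.1 (hA hex)).2
    linarith

end Summit.QuantumAdvantage.QuantumAdvantage.Theorems.DegreeOnePrimesEscape

end
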